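import Literature.NumberTheory.FaltingsSerre.ParamodularCited
import Literature.NumberTheory.FaltingsSerre.TypeGCriterion
import Literature.NumberTheory.FaltingsSerre.ParamodularCertificate
import HarnessLib

/-!
# `Jac(C₂₇₇)` is paramodular of level `277` away from `277` — the instance with the FORM SIDE CITED

[BPPTVY] = A. Brumer, A. Pacetti, C. Poor, G. Tornaría, J. Voight, D. S. Yuen, *On the paramodularity of
typical abelian surfaces*, Algebra & Number Theory **13**:5 (2019) 1145–1195 [cite: BrumerEtAl2019]
(printed numbering and pages): Thm 7.1.3 p. 1187 (`A₂₇₇ = Jac(y² + y = x⁵ − 2x³ + 2x² − x)` is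
paramodular; `P(277) = {3, …, 43}` p. 1188), Lemma 7.1.4 p. 1187 (Step 1: "`ρ̄_f,₂ ≃ ρ̄_A,₂` are equivalent
and absolutely irreducible" — proved from `img ρ̄_f ∈ {A₅, S₅, A₆, S₆}` via (6.2.4) at `p = 3, 5`, the
ramification bound `ord₂₇₇(d_F) ≤ 1` [Lemma 4.3.10], the Jones–Roberts quintic/sextic lists for
`{2, 277}` and (5.1.8)), p. 1188 ("we apply Lemma 4.3.8(b) … descend to `ρ_A, ρ_f : Gal_{ℚ,S} → GSp₄(ℤ₂)`";
"to conclude we will show that `tr ρ_A(Frob_p) = tr ρ_f(Frob_p)`"), Thm 4.3.4 p. 1169, Prop 4.3.2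
p. 1168 (type (G)), §6.2 (6.2.2) p. 1179 (`f₂₇₇`).

WHAT THIS FILE IS.  The `N = 277` instance of the cited-form template
`paramodular_of_galoisCertificate_cited` (`ParamodularCited.lean`, cell record `DIVERGENCE.md` D-29),
companion of `Paramodular277.paramodular_277` / `ParamodularUnconditional.paramodular_277_holds` /
`paramodular_277_of_conjCertificate`.  Compared with those, the form-side objects are NO LONGER POSITED:
there is no binder `ρf`, no `similitude₂`, no `residual_conj`/`residual_eq`, no `hρf_unr`, no `hρf` —
they come from the cited named fact `BrumerEtAl2019.existsIntegralSymplecticGaloisRep_two_primeLevel`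
(`FormGaloisRepTwoAdic.lean`: [Thm 4.3.4 p. 1169 + Lemmas 4.3.6/4.3.8/4.3.10 pp. 1170–1172, as used p. 1188], ARTHUR-DEPENDENT),
instantiated at `N = 277` from `hcusp`, `hne`, `hfe` and the type-(G) check at `p₀ = 3`, which is
DECIDED here from `Q₃(f₂₇₇, T) = 1 + T + T² + 3T³ + 9T⁴`, i.e. `(a₃, b₃) = (−1, 1)` (`typeG_of_ineq`:
`21 ≥ 0`, `1 ≤ 48`, `7 ≥ 0`, `12 ≤ 49`).  What the certificate must attest is now
* `GaloisCertificate277 ρA := GaloisCertificate 277 P(277) cyclotomicMultiplier ρA` — the CURVE-SIDE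
  Galois half (D-27): `similitude` (`ρ_{A,2}` is `GSp(J)`-valued with multiplier `χ₂`, `J = antiIdAlt4`,
  [(4.1.3) p. 1163], Weil pairing), `absIrreducible` (image `S₅(b)`, [Lemma 7.1.4]), `complete`
  (Steps 2–4 for `ρ̄_A`, `S` = places over `{2, 277}`, check places over `P(277)`) ↔ the Galois
  sub-certificate `certs/277/galois/galois_certificate.canonical.json`
  (sha256 `b54f56e443abc76ac03f62d8ec56e66f9b50812f389c60f619d6575e4ff69d7b`);
* `hres : ResidualIdentification 277 af bf ρA` — the LOGICAL CONTENT of [Lemma 7.1.4]: every continuous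
  `σ̄ : Gal_ℚ → Sp₄(𝔽₂)` unramified outside `{2, 277}`, with Frobenius polynomials
  `X⁴ + āX³ + b̄X² + āX + 1`, `(a, b) = (a_p(f), b_p(f))`, at the odd primes `p ≠ 277` and inertia at
  `277` acting through `1` or a transvection, is `ι(S₆)`-conjugate to `ρ̄_{A,2}` ↔ the `residual` block
  of the merged certificate `certs/277/certificate.canonical.json`
  (sha256 `34d2c59ac68941cd3c62e37f635b59d9841542e7b9f98dd8655a043277d83155`; candidate fields =
  the two Jones–Roberts quintics, `JR2` excluded by the Frobenius cycle type at `p = 3`, `JR1 ≅ ℚ(A[2])`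
  ×2; image `S₅(b)`; Route T of `ConjCertificateRoutes.lean`) — whether that block ATTESTS `hres` as
  typed is a referee ruling (the cell's reading so far was "ρ̄_f = ι(π) ρ̄_A ι(π)⁻¹ for the cited ρ_f");
* the integer data: `hA` (good reduction of `A` at `p ≠ 277` with `L_p` in surface shape), `hfe` (the
  spinor Euler factors of `f`), `h5` (Step 5 trace table on `P(277)`), `hf3` (`Q₃(f)`), `h2` (`p = 2` by
  hand [p. 1188]: `L₂ = Q₂ = 1 + 2T + 4T² + 4T³ + 4T⁴`, `(a₂, b₂) = (−2, 4)` on both sides in the cell's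
  tables; only `aA 2 = af 2 ∧ bA 2 = bf 2` enters).
TRUST BASE of `paramodular_277_cited`: the cited fact `h438` (Arthur via Mok) + the attested
`GaloisCertificate277` and `ResidualIdentification` + integer tables; the Faltings–Serre criterion is the
tree theorem `traceEq_of_faltingsSerre_symplectic_holds`.  Nothing here supersedes the landed instances.
-/

noncomputable section

namespace Literature.NumberTheory.FaltingsSerre.Paramodular277

open Polynomial IsDedekindDomain Field
open Literature.NumberTheory.FaltingsSerre Literature.NumberTheory.GaloisRepresentations
  Literature.NumberTheory.FaltingsSerre.GSp4F2
  Literature.NumberTheory.Automorphic.Paramodular Literature.NumberTheory.Automorphic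
  Literature.AlgebraicGeometry.Motives
open scoped NumberField

/-- The thirteen printed check primes `P(277) = {3,5,7,11,13,17,19,23,29,31,37,41,43}`
(`data277.checkPrimes`) are good odd primes: prime, `∤ 277`, `≠ 2` (hypothesis `hT` of the template).
[cite: BrumerEtAl2019, Thm 7.1.3 p. 1188] -/
theorem checkPrimes277_good : ∀ p ∈ data277.checkPrimes.toFinset, p.Prime ∧ ¬ p ∣ 277 ∧ p ≠ 2 := by
  decide

/-- **The curve-side Galois half of the `277` certificate, as a hypothesis**:
`GaloisCertificate 277 P(277) χ₂ ρA` for a frame `ρA` of `ρ_{A₂₇₇,2}` — `similitude` for `J = antiIdAlt4 ℤ_[2]`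
and multiplier `cyclotomicMultiplier = χ₂` [(4.1.3)], `absIrreducible` and `complete` (Steps 2–4, check
places over `P(277)`) ↔ `certs/277/galois/galois_certificate.canonical.json`
(sha256 `b54f56e4…4ff69d7b`).  A `Prop` used as a binder, never a Literature fact.
[cite: BrumerEtAl2019, Alg 2.4.1 p. 1155; (4.1.3) p. 1163; Thm 7.1.3 p. 1187] -/
def GaloisCertificate277 (ρA : FramedGaloisRep ℚ ℤ_[2] 4) : Prop :=
  GaloisCertificate 277 data277.checkPrimes.toFinset cyclotomicMultiplier ρA

/-- **Type (G) for `f₂₇₇` at `p₀ = 3`, decided.**  If the form's Euler data at `3` are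
`(a₃, b₃) = (−1, 1)`, i.e. `Q₃(f₂₇₇,T) = 1 + T + T² + 3T³ + 9T⁴` ([BPPTVY, (6.2.2) and Table of
eigenvalues; cell: `certs/277/eng2_form_hecke_277.json`, `Q_p.3 = [1,1,1,3,9]`, two sources agree]),
then all roots of `Q₃` have absolute value `3^{−1/2}` (`typeG_of_ineq`: `a² − 4b + 8p = 21 ≥ 0`,
`a² = 1 ≤ 48`, `2p + b = 7 ≥ 0`, `4a²p = 12 ≤ 49`), which is the type-(G) hypothesis `hG` of the cited
fact in its `∃ p₀` form. [cite: BrumerEtAl2019, Prop 4.3.2 p. 1168; Thm 4.3.4 p. 1169] -/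
theorem typeG_277_at_three (af bf : ℕ → ℤ) (hf3 : af 3 = -1 ∧ bf 3 = 1) :
    ∃ p : ℕ, p.Prime ∧ ¬ p ∣ 277 ∧ ∀ z : ℂ,
      ((lPolynomialOfSurface p (af p) (bf p)).map (Int.castRingHom ℂ)).IsRoot z →
        ‖z‖ = (Real.sqrt p)⁻¹ :=
  exists_typeG_of_ineq (N := 277) (p₀ := 3) (by norm_num) (by norm_num) af bf
    (by rw [hf3.1, hf3.2]; norm_num) (by rw [hf3.1]; norm_num) (by rw [hf3.2]; norm_num)
    (by rw [hf3.1, hf3.2]; norm_num)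

/-- **`Jac(C₂₇₇)` is paramodular of level `277` away from `277`, with the form side cited**
([BPPTVY, Thm 7.1.3] restricted to `p ≠ 277`, kernel target `IsParamodularAwayFrom A 277 f`).
`paramodular_of_galoisCertificate_cited` at `N = 277`, `T = P(277)`.  Binders: `h438` the cited
form-side fact [Thm 4.3.4 p. 1169 + Lemmas 4.3.6/4.3.8/4.3.10 pp. 1170–1172, as used p. 1188] (Arthur-dependent); `G` the curve-side
Galois half (sha256 above); `hframe` the Tate-module frame [(4.1.3)]; `aA bA` / `af bf` the Euler data in
surface shape with `hA` (good reduction, `cond(A) = 277`) and `hfe` (spinor Euler factors of `f`,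
[(4.2.18)]); `hres` the residual identification datum [Lemma 7.1.4] (certificate block `residual`);
`h5` the Step-5 trace table on `P(277)` [p. 1188]; `hcusp`, `hne` (`f ∈ S₂(K(277))` nonzero,
[(6.2.2)]); `hf3` the form's Euler data at `3` (type (G), decided by `typeG_277_at_three`); `h2` the
`p = 2` comparison by hand [p. 1188].  No `ρ_f`, no similitude or residual hypothesis about the form.
[cite: BrumerEtAl2019, Thm 7.1.3 p. 1187; Lemma 7.1.4 p. 1187; p. 1188; Thm 4.3.4 p. 1169; Alg 2.4.1 p. 1155; Thm 2.1.5 p. 1150] -/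
theorem paramodular_277_cited
    {A : AbelianVariety ℚ} {f : Matrix (Fin 2) (Fin 2) ℂ → ℂ} {ρA : FramedGaloisRep ℚ ℤ_[2] 4}
    {b : Module.Basis (Fin 4) ℚ_[2] (A.rationalTateModule 2)}
    (h438 : BrumerEtAl2019.existsIntegralSymplecticGaloisRep_two_primeLevel)
    (G : GaloisCertificate277 ρA)
    (hframe : A.IsFrameOfTateRep 2 b (rationalize ρA)) (aA bA af bf : ℕ → ℤ)
    (hres : ResidualIdentification 277 af bf ρA)
    (hA : ∀ p : ℕ, p.Prime → ¬ p ∣ 277 →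
      A.HasGoodEulerFactorAt p ((lPolynomialOfSurface p (aA p) (bA p)).map (Int.castRingHom ℚ)))
    (h5 : ∀ p ∈ data277.checkPrimes.toFinset, aA p = af p)
    (hcusp : IsParamodularCuspForm 277 2 f) (hne : ∃ Z ∈ siegelUpperHalfSpace 2, f Z ≠ 0)
    (hfe : ∀ p : ℕ, p.Prime → ¬ p ∣ 277 →
      HasSpinorEulerFactorAt 2 p f ((lPolynomialOfSurface p (af p) (bf p)).map (Int.castRingHom ℂ)))
    (hf3 : af 3 = -1 ∧ bf 3 = 1) (h2 : aA 2 = af 2 ∧ bA 2 = bf 2) :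
    IsParamodularAwayFrom A 277 f :=
  haveI : Fact (Nat.Prime 277) := ⟨by norm_num⟩
  paramodular_of_galoisCertificate_cited (by norm_num) h438 G hframe aA bA af bf hres hA
    checkPrimes277_good h5 hcusp hne hfe (typeG_277_at_three af bf hf3) h2

end Literature.NumberTheory.FaltingsSerre.Paramodular277

end
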